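import Summits.NavierStokesRegularity.NavierStokesRegularity.Theorems.SwirlFreeBudgetEtaEnergyInequality
import Summits.NavierStokesRegularity.NavierStokesRegularity.Theorems.SwirlFreeBudgetEtaDrift
import HarnessLib

/-!
# SwirlFreeBudget, crux K-18.1 `EtaMoserBound`, step A.4: the absorbed energy inequality
# for `η = ω_θ/r` — every right-hand term is a multiple of the mass `∫_K H(η)` (seat nsreg-p4 g13)

Support file for the DORMANT route `SwirlThreshold` (crux stmt-NavierStokesRegularity-2002) and
planner nsreg-p2's ROUND-18 Appendix A (`R18-APPENDIX-EtaMoser.md`, §A.4–A.5).  With the energy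
inequality (sibling `…SwirlFreeBudgetEtaEnergyInequality`) and the absorbed drift term (sibling
`…SwirlFreeBudgetEtaDrift`), for the squared cut-off `Θ = ψ²` (`0 ≤ ψ ≤ 1`, `‖∇ψ‖ ≤ B`,
`tsupport ψ ⊆ K` compact), `|q| ≤ Q` supported in `K`, and `∫_K ‖W(s)‖² ≤ w̄` on the time
interval:

* `eta_energy_absorbed` — `χ(t)M(t) + ¼∫_{t₁}^t χG_H ≤ ∫_{t₁}^t (𝒦χ + |χ'|) m ds`,
  `m(s) = ∫_K H(f(s))`, `𝒦 = 18B² + 1728 B⁴ C_S⁶ w̄² + 2Q` (memo (A.2)–(A.4) combined: every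
  right-hand term is a multiple of `∫_K H(f)`);
* `eta_tenThirds_le` — **(A.5) before un-wrapping**: on `]T₀, T₁[` with `χ(T₀) = 0`, `χ = χ̃²`,
  the energy-class function `g = χ̃ Θ s(f)` satisfies
  `∬ |g|^{10/3} ≤ 5 C_S² ℛ^{2/3} ℛ`, `ℛ = ∫_{T₀}^{T₁} (𝒦χ + |χ'|) m`
  (`‖g(t)‖₂² = χM ≤ ℛ`, `¼∫χG_H ≤ ℛ`, `‖∇g‖₂² ≤ χ(G_H + 8B² m)`, and the tree's parabolic embedding
  `lintegral_rpow_tenThirds_le_of_slice_bounds`), the `η`-twin of `Seregin2020.swirl_moser_tenThirds_le`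
  with the drift cost `(1 + A)²` of CTZ22 instead of `‖V‖_{L^{10/3}}`.

WHAT THIS IS NOT: not NS regularity — estimates for the smooth swirl-free class; `EtaMoserBound`
stays OPEN here; no crux claim.
-/

-- the problem directory repeats the summit name (D-0017); core's `dupNamespace` linter fires
set_option linter.dupNamespace false

namespace Summit.NavierStokesRegularity.NavierStokesRegularity.Theorems.SwirlFreeBudget

open MeasureTheory Set Filter Topology Metric Function intervalIntegral
open scoped RealInnerProductSpace Laplacian ContDiff ENNReal NNReal
open Literature.Analysis Literature.Analysis.FluidPDE Literature.Analysis.FluidPDE.Seregin2020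

noncomputable section

section Absorbed

variable {W : ℝ → EuclideanSpace ℝ (Fin 3) → EuclideanSpace ℝ (Fin 3)}
  {f : ℝ → EuclideanSpace ℝ (Fin 3) → ℝ} {lo hi : ℝ}

/-- The slice mass `m(s) = ∫_K H(f(s, x)) dx` is integrable in time on compact subintervals of
`]lo, hi[` (Fubini: `H ∘ f` is continuous on the compact `[a, b] × K`). -/
theorem intervalIntegrable_sliceMass
    (hfc : ContinuousOn (fun p : ℝ × EuclideanSpace ℝ (Fin 3) => f p.1 p.2) (Ioo lo hi ×ˢ univ))
    {H : ℝ → ℝ} (hH : Continuous H) {K : Set (EuclideanSpace ℝ (Fin 3))} (hK : IsCompact K)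
    {m : ℝ → ℝ} (hm : ∀ s, m s = ∫ x in K, H (f s x)) {a b : ℝ} (ha : lo < a) (hab : a ≤ b) (hb : b < hi) :
    IntervalIntegrable m volume a b := by
  have hIcc : Icc a b ⊆ Ioo lo hi := fun r hr => ⟨lt_of_lt_of_le ha hr.1, lt_of_le_of_lt hr.2 hb⟩
  have cΦ : ContinuousOn (fun p : ℝ × EuclideanSpace ℝ (Fin 3) => H (f p.1 p.2)) (Icc a b ×ˢ K) :=
    (hH.comp_continuousOn hfc).mono (prod_mono hIcc (subset_univ _))
  have hI := cΦ.integrableOn_compact (isCompact_Icc.prod hK)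
    (μ := ((volume : Measure ℝ).prod (volume : Measure (EuclideanSpace ℝ (Fin 3)))))
  have hI' := hI.mono_set (prod_mono Ioc_subset_Icc_self Subset.rfl)
  rw [IntegrableOn, ← Measure.prod_restrict] at hI'
  have h2 := hI'.integral_prod_left
  rw [intervalIntegrable_iff_integrableOn_Ioc_of_le hab]
  exact h2.congr (ae_of_all _ fun s => (hm s).symm)

/-- **Slice bounds by the mass `m = ∫_K H(F)`** for the squared cut-off `Θ = ψ²`
(`0 ≤ ψ ≤ 1`, `‖∇ψ‖ ≤ B`, `tsupport ψ ⊆ K` compact) and `H ≥ 0`: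
`0 ≤ m`, `M = ∫H(F)Θ² ≤ m`, `P = ∫H(F)|∇Θ|² ≤ 4B² m`. -/
theorem eta_slice_mass_bounds {F : EuclideanSpace ℝ (Fin 3) → ℝ} (hF : Continuous F)
    {H : ℝ → ℝ} (hHc : Continuous H) (hH0 : ∀ v, 0 ≤ H v)
    {ψ Θ : EuclideanSpace ℝ (Fin 3) → ℝ} (hψ : ContDiff ℝ 1 ψ) (hψ0 : ∀ x, 0 ≤ ψ x) (hψ1 : ∀ x, ψ x ≤ 1)
    (hΘψ : ∀ x, Θ x = ψ x ^ 2) {B : ℝ} (hBψ : ∀ x, ‖gradient ψ x‖ ≤ B)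
    {K : Set (EuclideanSpace ℝ (Fin 3))} (hK : IsCompact K) (hψK : tsupport ψ ⊆ K) :
    0 ≤ ∫ x in K, H (F x) ∧ ∫ x, H (F x) * Θ x ^ 2 ≤ ∫ x in K, H (F x) ∧
      ∫ x, H (F x) * ‖gradient Θ x‖ ^ 2 ≤ 4 * B ^ 2 * ∫ x in K, H (F x) := by
  have hΘfun : Θ = fun y => ψ y ^ 2 := funext hΘψ
  have hΘ : ContDiff ℝ 1 Θ := by rw [hΘfun]; exact hψ.pow 2
  have hKc : IsClosed K := hK.isClosed
  have hψ0K : ∀ x, x ∉ K → ψ x = 0 := fun x hx => image_eq_zero_of_notMem_tsupport fun h => hx (hψK h)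
  have hΘ0K : ∀ x, x ∉ K → Θ x = 0 := fun x hx => by rw [hΘψ, hψ0K x hx]; ring
  have hΘK : tsupport Θ ⊆ K := closure_minimal (fun y hy => by by_contra h'; exact hy (hΘ0K y h')) hKc
  have hΘsq1 : ∀ x, Θ x ^ 2 ≤ 1 := fun x => by
    rw [hΘψ]
    have h1 : ψ x ^ 2 ≤ 1 := by nlinarith [hψ0 x, hψ1 x]
    nlinarith [sq_nonneg (ψ x)]
  have hgradΘ : ∀ x, ‖gradient Θ x‖ ^ 2 ≤ 4 * B ^ 2 := fun x => by
    rw [hΘfun, gradient_sq_apply hψ x, norm_smul, mul_pow, Real.norm_eq_abs, sq_abs]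
    have h1 : ψ x ^ 2 ≤ 1 := by nlinarith [hψ0 x, hψ1 x]
    have h2 : ‖gradient ψ x‖ ^ 2 ≤ B ^ 2 := pow_le_pow_left₀ (norm_nonneg _) (hBψ x) 2
    nlinarith [sq_nonneg (ψ x), sq_nonneg ‖gradient ψ x‖]
  have cHF : Continuous fun x => H (F x) := hHc.comp hF
  have iHK : IntegrableOn (fun x => H (F x)) K := cHF.continuousOn.integrableOn_compact hK
  refine ⟨setIntegral_nonneg hKc.measurableSet fun x _ => hH0 _, ?_, ?_⟩
  · rw [← setIntegral_eq_integral_of_forall_compl_eq_zero (s := K) (fun x hx => by simp [hΘ0K x hx])]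
    refine setIntegral_mono_on (iHK.mul_continuousOn ((hΘ.continuous.pow 2).continuousOn) hK) iHK
      hKc.measurableSet fun x _ => ?_
    calc H (F x) * Θ x ^ 2 ≤ H (F x) * 1 := mul_le_mul_of_nonneg_left (hΘsq1 x) (hH0 _)
      _ = H (F x) := mul_one _
  · have cg : Continuous fun x => ‖gradient Θ x‖ ^ 2 := (continuous_gradient_of_contDiff hΘ).norm.pow 2
    rw [← setIntegral_eq_integral_of_forall_compl_eq_zero (s := K) (fun x hx => by
      rw [gradient_eq_zero_of_notMem_tsupport (fun h => hx (hΘK h)), norm_zero]; ring),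
      ← MeasureTheory.integral_const_mul]
    refine setIntegral_mono_on (iHK.mul_continuousOn cg.continuousOn hK) (iHK.const_mul _)
      hKc.measurableSet fun x _ => ?_
    calc H (F x) * ‖gradient Θ x‖ ^ 2 ≤ H (F x) * (4 * B ^ 2) :=
          mul_le_mul_of_nonneg_left (hgradΘ x) (hH0 _)
      _ = 4 * B ^ 2 * H (F x) := by ring

/-- **The absorbed energy inequality for `η`** (memo (A.2)–(A.4) combined).  In the setting of
`eta_energy_inequality` with the squared cut-off `Θ = ψ²` (`ψ ∈ C¹`, `0 ≤ ψ ≤ 1`, `‖∇ψ‖ ≤ B`,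
`tsupport ψ ⊆ K ⊆ U`, `K` compact), `H = s²` (`s ∈ C¹`, `s ≥ 0`, `2s'² ≤ H''`), `|q| ≤ Q` with `q`
supported in `K`, and `∫_K ‖W(s)‖² ≤ w̄` for `s ∈ [t₁, t]`:
`χ(t) M(t) + ¼ ∫_{t₁}^t χ G_H ≤ ∫_{t₁}^t (𝒦 χ + |χ'|) m ds`,
`m(s) = ∫_K H(f(s))`, `𝒦 = 18B² + 1728 B⁴ C_S⁶ w̄² + 2Q`. -/
theorem eta_energy_absorbed
    (hf : ∀ τ ∈ Ioo lo hi, ContDiff ℝ 2 (f τ)) (hfax : ∀ τ ∈ Ioo lo hi, IsAxisymmetricScalar (f τ))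
    (hW : ∀ τ ∈ Ioo lo hi, ContDiff ℝ 1 (W τ))
    {U : Set (EuclideanSpace ℝ (Fin 3))}
    (hdiv : ∀ τ ∈ Ioo lo hi, ∀ x ∈ U, VectorCalculus.divergence (W τ) x = 0)
    (hfc : ContinuousOn (fun p : ℝ × EuclideanSpace ℝ (Fin 3) => f p.1 p.2) (Ioo lo hi ×ˢ univ))
    (hDc : ContinuousOn (fun p : ℝ × EuclideanSpace ℝ (Fin 3) => fderiv ℝ (f p.1) p.2) (Ioo lo hi ×ˢ univ))
    (hqfc : ContinuousOn (fun p : ℝ × EuclideanSpace ℝ (Fin 3) => radDerivQuot (f p.1) p.2) (Ioo lo hi ×ˢ univ))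
    (hWc : ContinuousOn (fun p : ℝ × EuclideanSpace ℝ (Fin 3) => W p.1 p.2) (Ioo lo hi ×ˢ univ))
    (hLc : ContinuousOn (fun p : ℝ × EuclideanSpace ℝ (Fin 3) =>
      (Δ (f p.1)) p.2 - fderiv ℝ (f p.1) p.2 (W p.1 p.2) + 2 * radDerivQuot (f p.1) p.2) (Ioo lo hi ×ˢ univ))
    (heq : ∀ x ∈ U, ∀ s ∈ Ioo lo hi, ∀ t ∈ Ioo lo hi, s ≤ t →
      f t x - f s x = ∫ τ in s..t, ((Δ (f τ)) x - fderiv ℝ (f τ) x (W τ x) + 2 * radDerivQuot (f τ) x))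
    {H sf : ℝ → ℝ} (hH : ContDiff ℝ 2 H) (hsf : ContDiff ℝ 1 sf) (hsf0 : ∀ v, 0 ≤ sf v)
    (hHs : ∀ v, H v = sf v ^ 2) (hs2 : ∀ v, 2 * deriv sf v ^ 2 ≤ deriv (deriv H) v)
    (hκ : ∀ v, deriv H v ^ 2 ≤ 2 * H v * deriv (deriv H) v)
    {ψ Θ : EuclideanSpace ℝ (Fin 3) → ℝ} (hψ : ContDiff ℝ 1 ψ) (hψ0 : ∀ x, 0 ≤ ψ x) (hψ1 : ∀ x, ψ x ≤ 1)
    (hΘψ : ∀ x, Θ x = ψ x ^ 2) (hΘax : IsAxisymmetricScalar Θ) {B : ℝ} (hB : 0 ≤ B)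
    (hBψ : ∀ x, ‖gradient ψ x‖ ≤ B)
    {K : Set (EuclideanSpace ℝ (Fin 3))} (hK : IsCompact K) (hψK : tsupport ψ ⊆ K) (hKU : K ⊆ U)
    {q : EuclideanSpace ℝ (Fin 3) → ℝ} (hqc : Continuous q) (hqK : ∀ x, x ∉ K → q x = 0)
    (hqax : IsAxisymmetricScalar q) {Q : ℝ} (hQ : ∀ x, |q x| ≤ Q)
    (hq : ∀ x : EuclideanSpace ℝ (Fin 3), x 0 * q x = fderiv ℝ (fun y => Θ y ^ 2) x (EuclideanSpace.single 0 1))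
    {χ : ℝ → ℝ} (hχ : ContDiff ℝ 1 χ) (hχ0 : ∀ s, 0 ≤ χ s)
    {t₁ t : ℝ} (h1 : lo < t₁) (h1t : t₁ ≤ t) (ht : t < hi) (hχ1 : χ t₁ = 0)
    {wbar : ℝ} (hwbar : ∀ s ∈ Icc t₁ t, ∫ x in K, ‖W s x‖ ^ 2 ≤ wbar)
    {M GH m : ℝ → ℝ}
    (hM : ∀ s, M s = ∫ x, H (f s x) * Θ x ^ 2)
    (hGH : ∀ s, GH s = ∫ x, deriv (deriv H) (f s x) * ‖gradient (f s) x‖ ^ 2 * Θ x ^ 2)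
    (hm : ∀ s, m s = ∫ x in K, H (f s x)) :
    χ t * M t + 1 / 4 * ∫ s in t₁..t, χ s * GH s ≤
      ∫ s in t₁..t, ((18 * B ^ 2 + 1728 * B ^ 4 *
          (SNormLESNormFDerivOfEqConst ℝ (volume : Measure (EuclideanSpace ℝ (Fin 3))) 2 : ℝ) ^ 6 * wbar ^ 2 +
          2 * Q) * χ s + |deriv χ s|) * m s := by
  set CS : ℝ := (SNormLESNormFDerivOfEqConst ℝ (volume : Measure (EuclideanSpace ℝ (Fin 3))) 2 : ℝ) with hCS
  set 𝒦 : ℝ := 18 * B ^ 2 + 1728 * B ^ 4 * CS ^ 6 * wbar ^ 2 + 2 * Q with h𝒦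
  -- the functionals
  obtain ⟨Pf, hPf⟩ : ∃ Pf : ℝ → ℝ, ∀ s, Pf s = ∫ x, H (f s x) * ‖gradient Θ x‖ ^ 2 := ⟨_, fun _ => rfl⟩
  obtain ⟨TW, hTW⟩ : ∃ TW : ℝ → ℝ, ∀ s, TW s = ∫ x, H (f s x) * ⟪W s x, gradient (fun y => Θ y ^ 2) x⟫ :=
    ⟨_, fun _ => rfl⟩
  obtain ⟨Tq, hTq⟩ : ∃ Tq : ℝ → ℝ, ∀ s, Tq s = ∫ x, H (f s x) * q x := ⟨_, fun _ => rfl⟩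
  -- regularity of the cut-offs
  have hΘfun : Θ = fun y => ψ y ^ 2 := funext hΘψ
  have hΘ : ContDiff ℝ 1 Θ := by rw [hΘfun]; exact hψ.pow 2
  have hKc : IsClosed K := hK.isClosed
  have hψ0K : ∀ x, x ∉ K → ψ x = 0 := fun x hx => image_eq_zero_of_notMem_tsupport fun h => hx (hψK h)
  have hΘ0K : ∀ x, x ∉ K → Θ x = 0 := fun x hx => by rw [hΘψ, hψ0K x hx]; ring
  have hΘK : tsupport Θ ⊆ K := closure_minimal (fun y hy => by by_contra h'; exact hy (hΘ0K y h')) hKc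
  have hΘc : HasCompactSupport Θ := hK.of_isClosed_subset (isClosed_tsupport _) hΘK
  have hΘU : tsupport Θ ⊆ U := hΘK.trans hKU
  have hqs : HasCompactSupport q := HasCompactSupport.intro hK hqK
  have hH0 : ∀ v, 0 ≤ H v := fun v => by rw [hHs]; exact sq_nonneg _
  have hH2 : ∀ v, 0 ≤ deriv (deriv H) v := fun v => (mul_nonneg zero_le_two (sq_nonneg _)).trans (hs2 v)
  have hQ0 : 0 ≤ Q := (abs_nonneg _).trans (hQ 0)
  -- (1) the energy inequality
  have hEI := eta_energy_inequality hf hfax hW hdiv hfc hDc hqfc hWc hLc heq hH hH0 hH2 hκ hΘ hΘc hΘU hΘax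
    hqc hqs hqax hq hχ hχ0 h1 h1t ht hχ1 hM hGH hPf hTW hTq
  -- (2) slice bounds on `[t₁, t]`
  have hIcc : Icc t₁ t ⊆ Ioo lo hi := fun r hr => ⟨lt_of_lt_of_le h1 hr.1, lt_of_le_of_lt hr.2 ht⟩
  have hslice : ∀ s ∈ Icc t₁ t, 0 ≤ m s ∧ M s ≤ m s ∧ Pf s ≤ 4 * B ^ 2 * m s ∧ -Tq s ≤ Q * m s ∧
      TW s ≤ 1 / 4 * GH s + 1 / 2 * Pf s + 1728 * B ^ 4 * CS ^ 6 * wbar ^ 2 * m s := by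
    intro s hs
    have hsI : s ∈ Ioo lo hi := hIcc hs
    have hF2 : ContDiff ℝ 2 (f s) := hf s hsI
    have cF : Continuous (f s) := hF2.continuous
    have cHF : Continuous fun x => H (f s x) := hH.continuous.comp cF
    have iHK : IntegrableOn (fun x => H (f s x)) K := cHF.continuousOn.integrableOn_compact hK
    obtain ⟨hm0, hMm, hPm⟩ := eta_slice_mass_bounds cF hH.continuous hH0 hψ hψ0 hψ1 hΘψ hBψ hK hψK
    rw [← hm s] at hm0 hMm hPm
    rw [← hM s] at hMm
    rw [← hPf s] at hPm
    refine ⟨hm0, hMm, hPm, ?_, ?_⟩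
    · -- `−T_q ≤ Q m`
      rw [hTq s, hm s, ← MeasureTheory.integral_neg, ← setIntegral_eq_integral_of_forall_compl_eq_zero (s := K)
        (fun x hx => by simp [hqK x hx]), ← MeasureTheory.integral_const_mul]
      refine setIntegral_mono_on ((iHK.mul_continuousOn hqc.continuousOn hK).neg) (iHK.const_mul _)
        hKc.measurableSet fun x _ => ?_
      have h1 : -q x ≤ Q := (neg_le_abs _).trans (hQ x)
      calc -(H (f s x) * q x) = H (f s x) * (-q x) := by ring
        _ ≤ H (f s x) * Q := mul_le_mul_of_nonneg_left h1 (hH0 _)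
        _ = Q * H (f s x) := by ring
    · -- the drift term
      have hdr := eta_transport_slice_le (hF2.of_le one_le_two) hsf hsf0 hHs hH hs2 (hW s hsI).continuous
        hψ hψ0 hΘψ hB hBψ hK hψK (δ := 1 / 4) (by norm_num)
      rw [← hGH s, ← hPf s, ← hm s] at hdr
      have hw2 : (∫ x in K, ‖W s x‖ ^ 2) ^ 2 ≤ wbar ^ 2 :=
        pow_le_pow_left₀ (setIntegral_nonneg hKc.measurableSet fun x _ => sq_nonneg _) (hwbar s hs) 2
      have hrest : 27 * B ^ 4 * (CS ^ 6 * (∫ x in K, ‖W s x‖ ^ 2) ^ 2 * m s) / (1 / 4) ^ 3 ≤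
          1728 * B ^ 4 * CS ^ 6 * wbar ^ 2 * m s := by
        rw [show 27 * B ^ 4 * (CS ^ 6 * (∫ x in K, ‖W s x‖ ^ 2) ^ 2 * m s) / (1 / 4 : ℝ) ^ 3 =
          1728 * B ^ 4 * CS ^ 6 * m s * (∫ x in K, ‖W s x‖ ^ 2) ^ 2 by ring]
        have hc : 0 ≤ 1728 * B ^ 4 * CS ^ 6 * m s := by positivity
        nlinarith [mul_le_mul_of_nonneg_left hw2 hc]
      rw [hTW s]
      linarith
  -- (3) integrate the slice bounds
  have hsub : uIcc t₁ t ⊆ Ioo lo hi := by rw [uIcc_of_le h1t]; exact hIcc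
  obtain ⟨T₁', hT₁'⟩ : ∃ T₁' : ℝ → ℝ, ∀ s, T₁' s = ∫ x, deriv H (f s x) *
      ⟪gradient (f s) x, gradient (fun y => Θ y ^ 2) x⟫ := ⟨_, fun _ => rfl⟩
  obtain ⟨Ta, hTa⟩ : ∃ Ta : ℝ → ℝ, ∀ s, Ta s = ∫ x, deriv H (f s x) * radDerivQuot (f s) x * Θ x ^ 2 :=
    ⟨_, fun _ => rfl⟩
  obtain ⟨cM, cGH, -, cPf, cTW, -⟩ :=
    continuousOn_eta_sliceFunctionals hfc hDc hqfc hWc hH hΘ hΘc hM hGH hT₁' hPf hTW hTa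
  have cTq : ContinuousOn Tq (Ioo lo hi) := by
    have h := continuousOn_integral_slice_of_eq_zero (I := Ioo lo hi) isOpen_univ hqs (subset_univ _)
      (Φ := fun z : ℝ × EuclideanSpace ℝ (Fin 3) => H (f z.1 z.2) * q z.2)
      ((hH.continuous.comp_continuousOn hfc).mul (hqc.comp continuous_snd).continuousOn)
      (fun s x hx => by simp [image_eq_zero_of_notMem_tsupport hx])
    exact h.congr fun s _ => hTq s
  have cχ : Continuous χ := hχ.continuous
  have cχ' : Continuous (deriv χ) := hχ.continuous_deriv le_rfl
  have iiM : IntervalIntegrable M volume t₁ t := (cM.mono hsub).intervalIntegrable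
  have iiGH : IntervalIntegrable GH volume t₁ t := (cGH.mono hsub).intervalIntegrable
  have iiPf : IntervalIntegrable Pf volume t₁ t := (cPf.mono hsub).intervalIntegrable
  have iiTW : IntervalIntegrable TW volume t₁ t := (cTW.mono hsub).intervalIntegrable
  have iiTq : IntervalIntegrable Tq volume t₁ t := (cTq.mono hsub).intervalIntegrable
  have iim : IntervalIntegrable m volume t₁ t := intervalIntegrable_sliceMass hfc hH.continuous hK hm h1 h1t ht
  have iiχ : ∀ {g : ℝ → ℝ}, IntervalIntegrable g volume t₁ t → IntervalIntegrable (fun s => χ s * g s) volume t₁ t :=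
    fun hg => hg.continuousOn_mul cχ.continuousOn
  have iL : IntervalIntegrable (fun s => 4 * (χ s * Pf s) + χ s * TW s - 2 * (χ s * Tq s) + |deriv χ s| * M s)
      volume t₁ t :=
    ((((iiχ iiPf).const_mul 4).add (iiχ iiTW)).sub ((iiχ iiTq).const_mul 2)).add
      (iiM.continuousOn_mul cχ'.abs.continuousOn)
  have iR₂ : IntervalIntegrable (fun s => (𝒦 * χ s + |deriv χ s|) * m s) volume t₁ t :=
    iim.continuousOn_mul ((continuous_const.mul cχ).add cχ'.abs).continuousOn
  have iR : IntervalIntegrable (fun s => 1 / 4 * (χ s * GH s) + (𝒦 * χ s + |deriv χ s|) * m s) volume t₁ t :=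
    ((iiχ iiGH).const_mul _).add iR₂
  have hmaj : ∀ s ∈ Icc t₁ t, 4 * (χ s * Pf s) + χ s * TW s - 2 * (χ s * Tq s) + |deriv χ s| * M s ≤
      1 / 4 * (χ s * GH s) + (𝒦 * χ s + |deriv χ s|) * m s := by
    intro s hs
    obtain ⟨hm0, hMm, hPm, hTqm, hTWb⟩ := hslice s hs
    have hχs := hχ0 s
    have e1 := mul_le_mul_of_nonneg_left hPm hχs
    have e2 := mul_le_mul_of_nonneg_left hTWb hχs
    have e3 := mul_le_mul_of_nonneg_left hTqm hχs
    have e4 := mul_le_mul_of_nonneg_left hMm (abs_nonneg (deriv χ s))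
    have e5 : 0 ≤ χ s * m s := mul_nonneg hχs hm0
    rw [h𝒦]
    nlinarith [e1, e2, e3, e4, e5, sq_nonneg B, hQ0]
  have hmono := intervalIntegral.integral_mono_on h1t iL iR hmaj
  rw [intervalIntegral.integral_add ((iiχ iiGH).const_mul _) iR₂, intervalIntegral.integral_const_mul] at hmono
  linarith [hEI, hmono]

end Absorbed

end

end Summit.NavierStokesRegularity.NavierStokesRegularity.Theorems.SwirlFreeBudget
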